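import Literature.AlgebraicGeometry.Resolution.KummerNormalForm
import Literature.AlgebraicGeometry.Resolution.MarkedIdeals
import Literature.AlgebraicGeometry.Resolution.KollarBlowupSequenceFunctors
import Literature.AlgebraicGeometry.Resolution.ResolutionOfSingularities
import Mathlib.AlgebraicGeometry.Noetherian
import HarnessLib

set_option linter.dupNamespace false -- mandated namespace of this single-conjunct summit

/-!
# Separated Giraud normal form from a pointwise boundary-free normal form

Crux `Picover` (stmt-ResolutionOfSingularities-0554), line `giraud-separated-base`, stub
`giraudNormalFormSep_of_pointwise_zero`.

**Setting.** `k` a field of characteristic `p`, `W` a regular integral scheme locally of finite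
type over `k`, `L` a `K(W)`-algebra (a field).

**Claim.** If at EVERY point `w ∈ W` some germ `b ∈ 𝒪_{W,w}` represents the class of `L`
(`y ^ p = b` for some `y ∈ L ∖ K(W)`) and is in Giraud normal form with respect to the EMPTY
family of boundary equations (`r = 0`, `x = Fin.elim0`), then the data asked for by the research
stub `stub_giraudNormalFormSep` of the line exist: a proper birational `ρ : W' → W` with `W'`
regular integral, an snc boundary `E` on `W'`, and at every `w' ∈ W'` an enumeration of the
boundary components through `w'` with local equations and a representative of the class of `L` at
`ρ w'` whose pull-back is in Giraud normal form.

**Proof.** Pure packaging: take `W' := W`, `ρ := 𝟙 W`, `E := []`.  The identity is proper and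
birational; the empty boundary has simple normal crossings on a regular locally Noetherian scheme
(`hasSNC_nil_of_isRegular`; `W` is locally Noetherian being locally of finite type over a field);
at `w'` there are no boundary components through `w'` (`r = 0`, the subtype
`{D // D ∈ [] ∧ _}` is empty, so `Fin.elim0` is a bijection onto it), and the given germ `b` at
`w' = (𝟙 W) w'` pulls back to itself under `(𝟙 W)^♯_{w'} = 𝟙`.  No statement item is restated.
-/

namespace Summit.ResolutionOfSingularities.ResolutionOfSingularities.Theorems.Picover.NormalFormSepOfPointwise

open CategoryTheory AlgebraicGeometry Literature.AlgebraicGeometry.Resolution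

/-- The identity of a scheme is birational (dense open `U := ⊤`). -/
private theorem isBirational_id' (X : Scheme.{0}) : IsBirational (𝟙 X) :=
  ⟨⊤, by simp [dense_univ], by simp [dense_univ], inferInstance⟩

/-- **Separated Giraud normal form from a pointwise boundary-free one.**  If `W` is regular and
every point of `W` carries a representative `b` of the class of `L` in Giraud normal form with
respect to NO boundary equations, then the conclusion of `stub_giraudNormalFormSep` holds with
`W' := W`, `ρ := 𝟙 W`, `E := []` (proper, birational, regular, integral, snc, and pointwise the
same representative with `r = 0`). -/
theorem giraudNormalFormSep_of_pointwise_zero : ∀ (p : ℕ) (k : Type) [Field k] [CharP k p] (W : Scheme.{0}) [IsIntegral W] (f : W ⟶ Spec (.of k)) [LocallyOfFiniteType f] (L : Type) [Field L] [Algebra W.functionField L], Scheme.IsRegular W → (∀ w : W, ∃ b : W.presheaf.stalk w, (∃ y : L, y ∉ (algebraMap W.functionField L).range ∧ y ^ p = algebraMap W.functionField L (algebraMap (W.presheaf.stalk w) W.functionField b)) ∧ GiraudNormalFormAt p (Fin.elim0 : Fin 0 → W.presheaf.stalk w) b) → ∃ (W' : Scheme.{0}) (ρ : W' ⟶ W)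 (E : List W'.IdealSheafData), IsProper ρ ∧ IsBirational ρ ∧ IsIntegral W' ∧ Scheme.IsRegular W' ∧ HasSNC E ∧ ∀ w' : W', ∃ (r : ℕ) (D : Fin r → {D : W'.IdealSheafData // D ∈ E ∧ w' ∈ D.support}) (x : Fin r → W'.presheaf.stalk w'), Function.Bijective D ∧ (∀ j, stalkIdeal (D j).1 w' = Ideal.span {x j}) ∧ ∃ b : W.presheaf.stalk (ρ.base w'), (∃ y : L, y ∉ (algebraMap W.functionField L).range ∧ y ^ p = algebraMap W.functionField L (algebraMap (W.presheaf.stalk (ρ.base w')) W.functionField b)) ∧ GiraudNormalFormAt p x ((ρ.stalkMap w').hom b) := by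
  intro p k _ _ W _ f _ L _ _ hWreg hpt
  haveI : IsLocallyNoetherian W := LocallyOfFiniteType.isLocallyNoetherian f
  refine ⟨W, 𝟙 W, [], inferInstance, isBirational_id' W, inferInstance, hWreg,
    hasSNC_nil_of_isRegular hWreg, fun w' => ?_⟩
  obtain ⟨b, hy, hb⟩ := hpt w'
  refine ⟨0, Fin.elim0, Fin.elim0, ⟨fun i => i.elim0, fun D => absurd D.2.1 (by simp)⟩,
    fun j => j.elim0, b, hy, ?_⟩
  -- `(𝟙 W)^♯_{w'} = 𝟙 (𝒪_{W,w'})` (`Scheme.Hom.stalkMap_id`), so the pull-back of `b` is `b`.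
  have key : ∀ φ : W.presheaf.stalk w' ⟶ W.presheaf.stalk w', φ = 𝟙 _ →
      GiraudNormalFormAt p (Fin.elim0 : Fin 0 → W.presheaf.stalk w') (φ.hom b) := by
    rintro φ rfl
    exact hb
  exact key _ (Scheme.Hom.stalkMap_id W w')

end Summit.ResolutionOfSingularities.ResolutionOfSingularities.Theorems.Picover.NormalFormSepOfPointwise
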